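import Literature.Geometry.Kaehler.ComplexProjectiveSpaceFubiniStudy
import Literature.Geometry.Kaehler.ProjectiveAffineChartDeriv
import Literature.Topology.FourManifolds.ComplexProjectiveLineClutching
import Mathlib.Geometry.Manifold.SmoothEmbedding
import HarnessLib

/-!
# The line `ℂℙ¹ ⊂ ℂℙ²` is a smooth embedding and a symplectic submanifold

Topic `Literature/Geometry/Kaehler`; about the tree's line
`Literature.Topology.FourManifolds.ComplexProjectiveSpace.lineIncl : ℂℙ¹ → ℂℙ²`,
`[v₀ : v₁] ↦ [v₀ : v₁ : 0]` (`Literature/Topology/FourManifolds/ComplexProjectiveLineClutching.lean`,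
where it is defined and proved continuous, with `ℂℙ¹` charted on the literal `EuclideanSpace ℝ (Fin 2)`
and `ℂℙ² = ComplexProjectivePlane` on `EuclideanSpace ℝ (Fin 4)`), and the Fubini–Study symplectic
form `CPn.fsForm` of `ComplexProjectiveSpaceFubiniStudy.lean`. Contents:

* `CPn.instIsManifoldOne` — `ℂℙ¹` is a `C^m` manifold at the literal model `𝓡 2` (re-export);
* `injective_lineIncl`, `isEmbedding_lineIncl`, `range_lineIncl` (`= {Z₂ = 0}`);
* in the affine charts `j` of `ℂℙ¹` and `j` of `ℂℙ²` (`j = 0, 1`) the line is the linear slice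
  `y ↦ E (y, 0)` for a real-linear isomorphism `E = lineEquiv : ℝ² × ℂ ≃ ℝ⁴`
  (`affineChart_lineIncl_affineChart_symm`), hence a `C^∞` immersion and a SMOOTH EMBEDDING in
  Mathlib's chart sense (`isSmoothEmbedding_lineIncl`);
* the differential of `toP ∘ lineIncl` (values in the complex-charted `ℙ²(ℂ)`) is `D ∘ realCoordinates⁻¹`
  with `D` complex-linear and injective (`hasMFDerivAt_toP_comp_lineIncl`; the kernel of the affine
  chart derivative is the fibre line, `qchartDeriv_eq_zero_iff`), so the line is a SYMPLECTIC
  submanifold: `ω(dι v, dι w) = g_FS(i D a, i D a) > 0` for `w = L (i L⁻¹ v)`, `a = L⁻¹ v`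
  (`fsForm_lineIncl_ne_zero`).

## References

* D. Huybrechts, *Complex Geometry* (2005), §2.1 pp. 56–57 (affine atlas, linear subspaces);
  §3.1 Examples 3.1.9 i) (Fubini–Study).
* D. McDuff, D. Salamon, *Introduction to Symplectic Topology*, 3rd ed. (2017), Example 4.3.5
  (complex submanifolds of Kähler manifolds are symplectic).
-/

noncomputable section

open scoped Manifold ContDiff Topology LinearAlgebra.Projectivization
open Set Function Module Projectivization
open Literature.NumberTheory.Transcendental Literature.AlgebraicGeometry.Motives.FubiniStudy
open Literature.Topology.FourManifolds Literature.Topology.FourManifolds.ComplexProjectiveSpace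

namespace Literature.Geometry.Kaehler

namespace CPn

/-- Local notation: `𝔼 n` is the model space `EuclideanSpace ℝ (Fin n)`. -/
local notation "𝔼" n:arg => EuclideanSpace ℝ (Fin n)

attribute [local instance] isManifold_complex_projectivization isManifold_real_projectivization

/-- `ℂℙ¹` is a `C^m` manifold at the literal model `EuclideanSpace ℝ (Fin 2)` (re-export of the
tree's instance keyed at `Fin (2 * 1)`, companion of `ComplexProjectiveSpace.instChartedSpaceOne`).
[folklore] -/
instance instIsManifoldOne (m : WithTop ℕ∞) : IsManifold (𝓡 2) m (ComplexProjectiveSpace 1) :=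
  inferInstanceAs (IsManifold (𝓡 (2 * 1)) m (ComplexProjectiveSpace 1))

/-! ### Point-set properties of the line -/

/-- The line `ℂℙ¹ → ℂℙ²` is injective. [folklore] -/
theorem injective_lineIncl : Injective lineIncl :=
  Projectivization.map_injective lineInclLinear lineInclLinear_injective

/-- The line is a (closed) topological embedding: continuous injective from a compact space to a
Hausdorff space. [folklore] -/
theorem isEmbedding_lineIncl : Topology.IsEmbedding lineIncl :=
  (continuous_lineIncl.isClosedEmbedding injective_lineIncl).isEmbedding

/-- The image of the line is `{Z₂ = 0}`, the complement of the affine chart domain `U₂`.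
[cite: HuybrechtsCG2005, §2.1 pp. 56–57] -/
theorem range_lineIncl : range lineIncl = {q : ComplexProjectivePlane | ¬ CoordNeZero 2 q} := by
  ext q
  constructor
  · rintro ⟨p, rfl⟩
    induction p using ComplexProjectiveSpace.ind with
    | h v =>
      rw [mem_setOf_eq, lineIncl_mk, coordNeZero_mk]
      simp
  · intro hq
    induction q using ComplexProjectiveSpace.ind with
    | h w =>
      rw [mem_setOf_eq, coordNeZero_mk, not_not] at hq
      have hw : (![w.1 0, w.1 1] : Fin 2 → ℂ) ≠ 0 := by
        intro h
        apply w.2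
        funext k
        fin_cases k
        · simpa using congrFun h 0
        · simpa using congrFun h 1
        · simpa using hq
      refine ⟨ComplexProjectiveSpace.mk ⟨![w.1 0, w.1 1], hw⟩, ?_⟩
      rw [lineIncl_mk]
      congr 1
      apply Subtype.ext
      funext k
      fin_cases k
      · rfl
      · rfl
      · simpa using hq.symm

/-! ### Small index identities on `Fin 2` -/

/-- `σ₁ w = (w₀, 1)`: the `0`-th coordinate. [folklore] -/
@[simp] theorem insertNth_one_apply_zero (w : Fin 1 → ℂ) :
    (Fin.insertNth (1 : Fin 2) (1 : ℂ) w : Fin 2 → ℂ) 0 = w 0 := by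
  simp [Fin.insertNth_apply_below]

/-- `σ₀ w = (1, w₀)`: the `1`-st coordinate. [folklore] -/
@[simp] theorem insertNth_zero_apply_one (w : Fin 1 → ℂ) :
    (Fin.insertNth (0 : Fin 2) (1 : ℂ) w : Fin 2 → ℂ) 1 = w 0 := by
  simp

/-- `(v₀, v₁, 0)_{castSucc j} = v_j`. [folklore] -/
theorem lineVec_apply_castSucc (v : Fin 2 → ℂ) (j : Fin 2) :
    (![v 0, v 1, (0 : ℂ)] : Fin 3 → ℂ) (Fin.castSucc j) = v j := by
  fin_cases j <;> rfl

/-- `ι(Uⱼ) ⊆ Uⱼ`: if `x ∈ ℂℙ¹` has `xⱼ ≠ 0` then `ι x ∈ ℂℙ²` has `(ι x)ⱼ ≠ 0`. [folklore] -/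
theorem coordNeZero_castSucc_lineIncl {j : Fin 2} {x : ComplexProjectiveSpace 1}
    (hx : CoordNeZero j x) : CoordNeZero (Fin.castSucc j) (lineIncl x) := by
  induction x using ComplexProjectiveSpace.ind with
  | h v =>
    rw [lineIncl_mk, coordNeZero_mk]
    show (![v.1 0, v.1 1, (0 : ℂ)] : Fin 3 → ℂ) (Fin.castSucc j) ≠ 0
    rw [lineVec_apply_castSucc]
    rwa [coordNeZero_mk] at hx

/-! ### The line in charts -/

/-- The line in the affine charts `j` (of `ℂℙ¹`) and `j` (of `ℂℙ²`), `j = 0, 1`: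
`φⱼ ∘ ι ∘ φⱼ⁻¹ (y) = realCoordinates 2 (L⁻¹ y, 0)`. [cite: HuybrechtsCG2005, §2.1 pp. 56–57] -/
theorem affineChart_lineIncl_affineChart_symm (j : Fin 2) (y : 𝔼 2) :
    affineChart (Fin.castSucc j) (lineIncl ((affineChart j).symm y)) =
      realCoordinates 2 ![(realCoordinates 1).symm y 0, 0] := by
  rw [affineChart_symm_apply, lineIncl_mk, affineChart_apply, affineCoord, comp_apply,
    affineCoordComplex_mk]
  congr 1
  funext k
  fin_cases j <;> fin_cases k <;> simp [homogenize]

/-- `ℂ¹ × ℂ ≃ₗ ℂ²`, `(w, c) ↦ (w₀, c)`. [folklore] -/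
def lineVecEquiv : ((Fin 1 → ℂ) × ℂ) ≃ₗ[ℝ] (Fin 2 → ℂ) where
  toFun p := ![p.1 0, p.2]
  invFun v := (fun _ ↦ v 0, v 1)
  map_add' p q := by
    funext k
    fin_cases k <;> simp
  map_smul' c p := by
    funext k
    fin_cases k <;> simp
  left_inv p := by
    ext k
    · simp [Fin.eq_zero k]
    · simp
  right_inv v := by
    funext k
    fin_cases k <;> simp

/-- The real-linear isomorphism `E : ℝ² × ℂ ≃ ℝ⁴`, `(y, c) ↦ realCoordinates 2 (L⁻¹ y, c)` (the
complement of the line direction is the coordinate `Z₂ / Zⱼ`). [folklore] -/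
def lineEquiv : (𝔼 2 × ℂ) ≃L[ℝ] 𝔼 4 :=
  (((realCoordinates 1).symm.prodCongr (ContinuousLinearEquiv.refl ℝ ℂ)).trans
    lineVecEquiv.toContinuousLinearEquiv).trans (realCoordinates 2)

/-- `E (y, c) = realCoordinates 2 (L⁻¹ y 0, c)`. [folklore] -/
theorem lineEquiv_apply (y : 𝔼 2) (c : ℂ) :
    lineEquiv (y, c) = realCoordinates 2 ![(realCoordinates 1).symm y 0, c] := rfl

/-- **The line is a `C^∞` immersion** (Mathlib's chart definition): around `x ∈ Uⱼ`, in the charts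
`φⱼ` of `ℂℙ¹` and `φⱼ` of `ℂℙ²` it is `y ↦ E (y, 0)`. [cite: HuybrechtsCG2005, §2.1 pp. 56–57] -/
theorem isImmersion_lineIncl : Manifold.IsImmersion (𝓡 2) (𝓡 4) ∞ lineIncl := by
  refine Manifold.IsImmersionOfComplement.isImmersion (F := ℂ) fun x ↦ ?_
  set j : Fin 2 := chartIndex x with hj
  refine Manifold.IsImmersionAtOfComplement.mk_of_continuousAt continuous_lineIncl.continuousAt
    lineEquiv (affineChart j) (affineChart (Fin.castSucc j)) (coordNeZero_chartIndex x) ?_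
    (IsManifold.subset_maximalAtlas ⟨j, rfl⟩) (IsManifold.subset_maximalAtlas ⟨Fin.castSucc j, rfl⟩) ?_
  · exact coordNeZero_castSucc_lineIncl (coordNeZero_chartIndex x)
  · intro y _
    simp only [comp_apply, OpenPartialHomeomorph.extend_coe, OpenPartialHomeomorph.extend_coe_symm,
      modelWithCornersSelf_coe, modelWithCornersSelf_coe_symm, id_eq, lineEquiv_apply]
    exact affineChart_lineIncl_affineChart_symm j y

/-- **The line `ℂℙ¹ ↪ ℂℙ²` is a smooth embedding.** [cite: HuybrechtsCG2005, §2.1 pp. 56–57] -/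
theorem isSmoothEmbedding_lineIncl : Manifold.IsSmoothEmbedding (𝓡 2) (𝓡 4) ∞ lineIncl :=
  ⟨isImmersion_lineIncl, isEmbedding_lineIncl⟩

/-! ### The differential of the line and the symplectic property -/

/-- In the preferred charts at `y` (real, index `j = chartIndex y`) and at `toP (ι y)` (complex,
index `c = cidx`) the map `toP ∘ ι` reads `qchart c ((σⱼ v)₀, (σⱼ v)₁, 0) ∘ realCoordinates⁻¹`.
[folklore] -/
theorem writtenInExtChartAt_toP_comp_lineIncl (y : ComplexProjectiveSpace 1) (u : 𝔼 2) :
    writtenInExtChartAt (𝓡 2) 𝓘(ℝ, Fin 2 → ℂ) y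
        ((CPn.toP : ComplexProjectivePlane → _) ∘ lineIncl) u =
      qchart (cidx (CPn.toP (lineIncl y)))
        (![(Fin.insertNth (chartIndex y) (1 : ℂ) ((realCoordinates 1).symm u) : Fin 2 → ℂ) 0,
           (Fin.insertNth (chartIndex y) (1 : ℂ) ((realCoordinates 1).symm u) : Fin 2 → ℂ) 1, 0]) := by
  simp only [writtenInExtChartAt, comp_apply]
  rw [CPn.extChartAt_symm_apply (n := 1), lineIncl_mk, CPn.toP_mk]
  exact stdChartFun_mk_eq_qchart _ _ _

/-- **Differential of the line**: `d(toP ∘ ι)_y = D ∘ realCoordinates⁻¹` with `D : ℂ¹ → ℂ²`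
complex-linear and INJECTIVE (`D = qchartDeriv c W ∘ A`, `A u = ((L_j u)₀, (L_j u)₁, 0)`,
`W = ((σⱼ w₀)₀, (σⱼ w₀)₁, 0)`; a kernel vector has `A u ∈ ℂ W`, and the `j`-th coordinates `0`, `1`
force `u = 0`). [cite: HuybrechtsCG2005, §2.1 pp. 56–57] -/
theorem hasMFDerivAt_toP_comp_lineIncl (y : ComplexProjectiveSpace 1) :
    ∃ D : (Fin 1 → ℂ) →L[ℂ] (Fin 2 → ℂ), Injective D ∧
      HasMFDerivAt (𝓡 2) 𝓘(ℝ, Fin 2 → ℂ) ((CPn.toP : ComplexProjectivePlane → _) ∘ lineIncl) y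
        ((D.restrictScalars ℝ) ∘L ((realCoordinates 1).symm : 𝔼 2 →L[ℝ] (Fin 1 → ℂ))) := by
  set j : Fin 2 := chartIndex y with hj
  set c : Fin 3 := cidx (CPn.toP (lineIncl y)) with hc
  set w₀ : Fin 1 → ℂ := affineCoordComplex j y with hw₀
  set W : Fin 3 → ℂ := ![(Fin.insertNth j (1 : ℂ) w₀ : Fin 2 → ℂ) 0,
    (Fin.insertNth j (1 : ℂ) w₀ : Fin 2 → ℂ) 1, 0] with hW
  set A : (Fin 1 → ℂ) →L[ℂ] (Fin 3 → ℂ) := lineInclLinear.toContinuousLinearMap ∘L liftL j with hA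
  have hy : ComplexProjectiveSpace.mk (homogenize j w₀) = y := by
    have h := (affineChart j).left_inv (coordNeZero_chartIndex y)
    have h' : (affineChart j).symm (affineChart j y) = ComplexProjectiveSpace.mk (homogenize j w₀) := by
      show ComplexProjectiveSpace.mk (homogenize j ((realCoordinates 1).symm
        (realCoordinates 1 (affineCoordComplex j y)))) = _
      rw [ContinuousLinearEquiv.symm_apply_apply]
    exact h'.symm.trans h
  have hWne : W ≠ 0 := by
    intro h
    have := congrFun h (Fin.castSucc j)
    rw [hW, lineVec_apply_castSucc] at this
    simp at this
  have hyW : CPn.toP (lineIncl y) = Projectivization.mk ℂ W hWne := by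
    conv_lhs => rw [← hy, lineIncl_mk, CPn.toP_mk]
    rfl
  have hWc : W c ≠ 0 := by
    have h : CPn.toP (lineIncl y) ∈ stdChartSource c := mem_stdChartSource_cidx _
    rw [hyW, mk_mem_stdChartSource_iff] at h
    exact h
  refine ⟨(qchartDeriv c W).comp A, ?_, ?_⟩
  · -- injectivity
    intro u u' huu'
    have h0 : qchartDeriv c W (A (u - u')) = 0 := by
      have := congrArg (fun z ↦ z - (qchartDeriv c W).comp A u') huu'
      simpa [map_sub] using this
    obtain ⟨a, ha⟩ := (qchartDeriv_eq_zero_iff c hWc _).1 h0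
    have hAj : A (u - u') (Fin.castSucc j) = 0 := by
      rw [hA, ContinuousLinearMap.comp_apply, LinearMap.coe_toContinuousLinearMap',
        lineInclLinear_apply, lineVec_apply_castSucc, liftL_apply, Fin.insertNth_apply_same]
    have hWj : W (Fin.castSucc j) = 1 := by
      rw [hW, lineVec_apply_castSucc, Fin.insertNth_apply_same]
    have ha0 : a = 0 := by
      have := congrFun ha (Fin.castSucc j)
      rw [hAj, Pi.smul_apply, hWj, smul_eq_mul, mul_one] at this
      exact this.symm
    have hA0 : A (u - u') = 0 := by rw [ha, ha0, zero_smul]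
    have h1 : (u - u') 0 = 0 := by
      have := congrFun hA0 (Fin.castSucc (j.succAbove 0))
      rw [hA, ContinuousLinearMap.comp_apply, LinearMap.coe_toContinuousLinearMap',
        lineInclLinear_apply, lineVec_apply_castSucc, liftL_apply, Fin.insertNth_apply_succAbove] at this
      simpa using this
    have : u - u' = 0 := by
      funext k
      rw [Fin.eq_zero k]
      simpa using h1
    exact sub_eq_zero.1 this
  · -- the derivative
    refine ⟨(CPn.continuous_toP.comp continuous_lineIncl).continuousAt, ?_⟩
    have hwr : writtenInExtChartAt (𝓡 2) 𝓘(ℝ, Fin 2 → ℂ) y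
        ((CPn.toP : ComplexProjectivePlane → _) ∘ lineIncl) = fun u ↦ qchart c
          (![(Fin.insertNth j (1 : ℂ) ((realCoordinates 1).symm u) : Fin 2 → ℂ) 0,
             (Fin.insertNth j (1 : ℂ) ((realCoordinates 1).symm u) : Fin 2 → ℂ) 1, 0]) :=
      funext (writtenInExtChartAt_toP_comp_lineIncl y)
    have hpt : extChartAt (𝓡 2) y y = realCoordinates 1 w₀ := rfl
    rw [hwr, hpt, modelWithCornersSelf_coe, range_id, hasFDerivWithinAt_univ]
    have hσ : HasFDerivAt (fun v : Fin 1 → ℂ ↦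
        (![(Fin.insertNth j (1 : ℂ) v : Fin 2 → ℂ) 0, (Fin.insertNth j (1 : ℂ) v : Fin 2 → ℂ) 1, 0] :
          Fin 3 → ℂ)) (A.restrictScalars ℝ) ((realCoordinates 1).symm (realCoordinates 1 w₀)) := by
      have h := (lineInclLinear.toContinuousLinearMap.hasFDerivAt.comp _
        (hasFDerivAt_insertNth_one j ((realCoordinates 1).symm (realCoordinates 1 w₀)))).restrictScalars ℝ
      exact h
    have hq : HasFDerivAt (qchart c) (qchartDeriv c W)
        ((fun v : Fin 1 → ℂ ↦ (![(Fin.insertNth j (1 : ℂ) v : Fin 2 → ℂ) 0,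
          (Fin.insertNth j (1 : ℂ) v : Fin 2 → ℂ) 1, 0] : Fin 3 → ℂ))
          ((realCoordinates 1).symm (realCoordinates 1 w₀))) := by
      simp only [ContinuousLinearEquiv.symm_apply_apply]
      exact hasFDerivAt_qchart c hWc
    have h3 := ((hq.restrictScalars ℝ).comp ((realCoordinates 1).symm (realCoordinates 1 w₀)) hσ).comp
      (realCoordinates 1 w₀) (realCoordinates 1).symm.hasFDerivAt
    exact h3

/-- **The line is a symplectic submanifold for the Fubini–Study form of `ℂℙ²`**: for every tangent
vector `v ≠ 0` of `ℂℙ¹` there is `w` with `ω_FS(dι v, dι w) ≠ 0` — `ω_FS(dι v, dι w) =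
ω(d(toP∘ι) v, d(toP∘ι) w) = ω(D a, i D a) = g_FS(i Da, i Da) > 0` for `w = L (i L⁻¹ v)`, `a = L⁻¹ v`,
since `D` is complex-linear and injective. McDuff–Salamon (2017), Example 4.3.5.
[cite: HuybrechtsCG2005, §3.1 Examples 3.1.9 i) pp. 117–118] -/
theorem fsForm_lineIncl_ne_zero (y : ComplexProjectiveSpace 1) (v : TangentSpace (𝓡 2) y) (hv : v ≠ 0) :
    ∃ w : TangentSpace (𝓡 2) y,
      CPn.fsForm 2 (lineIncl y)
        ![mfderiv (𝓡 2) (𝓡 4) lineIncl y v, mfderiv (𝓡 2) (𝓡 4) lineIncl y w] ≠ 0 := by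
  obtain ⟨D, hD, hderiv⟩ := hasMFDerivAt_toP_comp_lineIncl y
  have hv' : (realCoordinates 1).symm v ≠ 0 := by
    intro h
    apply hv
    calc v = realCoordinates 1 ((realCoordinates 1).symm v) := by simp
      _ = 0 := by rw [h, map_zero]
  have hDa : D ((realCoordinates 1).symm v) ≠ 0 := fun h ↦ hv' (hD (by rw [h, map_zero]))
  have hι : MDifferentiableAt (𝓡 2) (𝓡 4) lineIncl y :=
    isSmoothEmbedding_lineIncl.contMDiff.mdifferentiableAt (by simp) (x := y)
  have hcomp := mfderiv_comp y (CPn.mdifferentiableAt_toP (lineIncl y)) hι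
    (I' := 𝓡 4) (I'' := 𝓘(ℝ, Fin 2 → ℂ)) (g := (CPn.toP : ComplexProjectivePlane → _))
  have hmf : ∀ u : TangentSpace (𝓡 2) y,
      mfderiv (𝓡 4) 𝓘(ℝ, Fin 2 → ℂ) (CPn.toP : ComplexProjectivePlane → _) (lineIncl y)
        (mfderiv (𝓡 2) (𝓡 4) lineIncl y u) = D ((realCoordinates 1).symm u) := fun u ↦ by
    have e1 : mfderiv (𝓡 4) 𝓘(ℝ, Fin 2 → ℂ) (CPn.toP : ComplexProjectivePlane → _) (lineIncl y)
        (mfderiv (𝓡 2) (𝓡 4) lineIncl y u) =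
        mfderiv (𝓡 2) 𝓘(ℝ, Fin 2 → ℂ) ((CPn.toP : ComplexProjectivePlane → _) ∘ lineIncl) y u := by
      rw [hcomp]
      rfl
    rw [e1, hderiv.mfderiv]
    rfl
  have hDI : D (Complex.I • (realCoordinates 1).symm v) = Complex.I • D ((realCoordinates 1).symm v) :=
    map_smul D _ _
  refine ⟨realCoordinates 1 (Complex.I • (realCoordinates 1).symm v), ?_⟩
  rw [CPn.fsForm_apply, hmf, hmf, ContinuousLinearEquiv.symm_apply_apply, hDI,
    Bundle.RiemannianMetric.kaehlerForm_apply_of_isHermitian _ isHermitian_fubiniStudyMetric,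
    tangentJ_apply]
  have hI : (Complex.I • D ((realCoordinates 1).symm v) : Fin 2 → ℂ) ≠ 0 :=
    smul_ne_zero Complex.I_ne_zero hDa
  exact ((fubiniStudyMetric (n := 2)).toRiemannianMetric.pos _ _ hI).ne'

end CPn

end Literature.Geometry.Kaehler
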